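import Summits.QuantumFields.YangMills.Theorems.BalabanUVNodesN19RekeyingAbsorptionClassForm
import Summits.QuantumFields.YangMills.Theorems.BalabanUVNodesSpineReadingOfRecord13CoPHK

/-!
# BalabanUVNodes ∕ node N19 (NE7) — THE LAW-MERGE SOCKET AT A KEY READING: at dag-n20-d's spine reading with a key-reading dial `crOfRecord₁₃KAt K₀ kr bd 0` (zero shells) the
# N19′ ∧ N20 face bodies of K3⁷ stub 2 FOLLOW, in the reading's own canonical currency, from the three law-merge letters read at the coarse carriers — (Y) young class factors
# matched, (D) the class form of p613310 on the GOOD coarse classes, NE7b for the FLAGGED ones — for EVERY dial; the window dial of record is the named instance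

Cell `pub-ymgap` (HUMAN RULING D-0062 Track A ∕ D-0149 width seats), WIDTH SEAT `pub-ymgap-dag-n19-w1` (node n19 = NE7, seat 1 of 3), generation g4, INTENT-8.  Route
`Summits/QuantumFields/YangMills/Theses/BalabanUVNodes.lean`, key item K3⁷ `SpineGivenEndpointR13SepCoPH` (stmt-QuantumFields-20544; v5 stub 2 `stub_expansion13H`, conjuncts N19′
`KeyedCoreEdgeHolderD4` ∧ N20 `KeyedRelWeight` at ONE reading; plan g83 WORDS-4 bookings (1)+(7) «re-key the core law at the window key»); filed `--kind proof --supports … --as helper`.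
COUNT-NEUTRAL.  THEOREMS ONLY (0 `def`, 0 `sorry`).  ADDITIVE — imports this seat's g4 `…Theorems.BalabanUVNodesN19RekeyingAbsorptionClassForm` (p613310 ∕ v1.1 p618673:
`core_of_classFactorisation`) and dag-n20-d's `…Theorems.BalabanUVNodesSpineReadingOfRecord13CoPHK` (p608328: `crOfRecord₁₃KAt`, `classSetK₁₃ ∕ weightAK₁₃ ∕ weightBK₁₃ ∕ badClassK₁₃`,
`weightAK₁₃_nonneg`, `core_crOfRecord₁₃KAt`, `relWeightBound_crOfRecord₁₃KAt`, `windowKeyReading₁₃`); modifies nothing.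

WHY.  p615521 says what the v5 PIN gives at a key reading (descent under a covering flag) and what it does not (window + persistence flag).  The re-keyed stub of the v6 move will
instead be PROVED at the key reading from the law-merge letters.  THIS FILE types the socket such a proof fills, on the tree's reading object, so that the plan can read the re-keyed
N19′ ∧ N20 pair as «three letters at the coarse carriers ⇒ the two face bodies at `crOfRecord₁₃KAt K₀ kr bd 0` in its canonical `W ∕ δ`»:
* §1 [bookkeeping] ★★★ `faces_crOfRecord₁₃KAt_zeroShell_of_lawMergeLetters` — for ANY dial `kr : KeyReading₁₃` and ANY bad-key reading `bd`, at one tuple: (Y) `Core 1 (F.side^4) classSetK₁₃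
  badClassK₁₃ m_A m_B r`; (D) on the GOOD coarse classes `weightAK₁₃ ∈ e^{±s_A}·m_A·R_A(K)`, `weightBK₁₃ ∈ e^{±s_B}·m_B·R_B(K)` with moduli bounded by `S_A, S_B`, `m_A ≥ 0`, `R_A, R_B > 0`;
  NE7b `RelWeightBound 1 classSetK₁₃ weightAK₁₃ weightBK₁₃ badClassK₁₃ W`; `weightA₁₃ ≥ 0`; `r + (S_A+S_B)∕F.side^4` summable ⇒ at `cr := crOfRecord₁₃KAt K₀ kr bd 0 F θ hP g₀ os`:
  `RelWeightBound cr… cr.Bad cr.W ∧ Core cr… (cr.A − cr.shA) (cr.B − cr.shB) cr.δ ∧ Summable cr.δ` (dag-n20-d's transfers + p613310 BY NAME).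
* §2 [bookkeeping] ★ `faces_windowReading_zeroShell_of_lawMergeLetters` — the instance at the window dial of record `windowKeyReading₁₃ K₀ c` with an arbitrary bad-key reading
  (e.g. the first-window-level flag `KeyOldLargeField (c … K + 1)` or n20-w3's forgiving flag).
READING (located; nothing proposed).  This is the v6 move's stub-2 body at a key reading, MINUS the universal tuple prefix and the N21∕N27x conjuncts (zero shells; extraction is
dag-n20-d's `keyedExtraction_crOfRecord₁₃KAt`): a re-keyed stub would be closed tuple by tuple by exhibiting the three letters.  None of them is printed for d = 4; nothing here proves one.

HONEST FRAMING.  By-name plumbing over dag-n20-d's reading object and this seat's class form; the letters are HYPOTHESES; nothing of Bałaban's is asserted or instantiated; no estimate of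
the programme is proved.  NE7 ∕ NE7b NOT PRINTED as two-run statements for d = 4 ∕ NOT proved; N19 ∕ N20 NOT discharged; K3⁷ OPEN, not claimed, v5 untouched; counts UNMOVED (typed
28∕28 · discharged 5∕27, A 5∕28).  Everything below is PROVED (0 `sorry`, 0 named facts, standard axioms); no decl carries a cite tag.  One finite four-torus programme at fixed ε —
NOT ℝ⁴, NOT infinite volume, NOT OS, NOT a mass gap, NOT the Clay problem (R4 closes the conditional finite-𝕋⁴ rung `BalabanLadder.UV` only).
-/

noncomputable section

open Finset
open scoped BigOperators

namespace Summit.QuantumFields.YangMills.BalabanUVNodes.N19LawMergeSocketAtKeyReading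

open Summit.QuantumFields.BalabanUV.T4Continuum.Spine.NE7 (Core)
open Literature.MathematicalPhysics.QuantumFieldTheory.Balaban1983to89
open Literature.MathematicalPhysics.QuantumFieldTheory.Balaban1983to89.T4Continuum
open Literature.MathematicalPhysics.QuantumFieldTheory.Balaban1983to89.Node00
open T4WeightBudget (RelWeightBound)
open YMDAG.UVSplit
open Summit.QuantumFields.YangMills.BalabanUVNodes.N19RekeyingAbsorptionClassForm (core_of_classFactorisation)

variable {F : T4Family} {N : ℕ} [NeZero N] (K₀ : ℕ) (kr : KeyReading₁₃ N K₀) (bd : BadKeyReading₁₃ N K₀) (θ : Stage13HParams F N) (hP : θ.Provisos₁₃CoPH F N)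
  (g₀ : ℕ → ℝ) (os : List (ULoop F))

/-! ## §1 The socket at any dial [bookkeeping] -/

/-- **★★★ THE N19′ ∧ N20 FACE BODIES AT `crOfRecord₁₃KAt K₀ kr bd 0` FROM THE LAW-MERGE LETTERS** [bookkeeping].  At one tuple, for ANY dial and bad-key reading, from
(Y) the young class factors' `Core`, (D) the class form of the two runs' coarse class weights on the GOOD coarse classes (class-dependent moduli bounded by `S_A, S_B`; class- and
source-independent old scalars `R_A, R_B > 0`), NE7b `RelWeightBound` of the FLAGGED coarse classes, non-negative class weights of record and a summable radius: the reading with the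
ZERO shell split carries `RelWeightBound` (with its canonical `W`) and `Core` (with its canonical `δ`, summable) — the N20 and N19′ face bodies of stub 2 at that reading
(p613310 `core_of_classFactorisation` + dag-n20-d's `core_crOfRecord₁₃KAt` ∕ `relWeightBound_crOfRecord₁₃KAt` BY NAME). -/
theorem faces_crOfRecord₁₃KAt_zeroShell_of_lawMergeLetters
    {mA mB sA sB : ℕ → ℝ → (Σ K, SiteSeqKey F (K₀ + K)) → ℝ} {RA RB SA SB r W : ℕ → ℝ}
    (hyoung : letI : DecidableEq (Σ K, SiteSeqKey F (K₀ + K)) := Classical.decEq _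
      Core 1 ((F.side : ℝ) ^ 4) (classSetK₁₃ θ K₀ g₀ (kr F θ hP g₀ os)) (badClassK₁₃ θ K₀ g₀ (kr F θ hP g₀ os) (bd F θ hP g₀ os)) mA mB r)
    (hA : letI : DecidableEq (Σ K, SiteSeqKey F (K₀ + K)) := Classical.decEq _
      ∀ (K : ℕ) (t : ℝ), |t| ≤ 1 → ∀ u ∈ classSetK₁₃ θ K₀ g₀ (kr F θ hP g₀ os) K \ badClassK₁₃ θ K₀ g₀ (kr F θ hP g₀ os) (bd F θ hP g₀ os) K t,
        Real.exp (-sA K t u) * (mA K t u * RA K) ≤ weightAK₁₃ θ hP K₀ g₀ os (kr F θ hP g₀ os) K t u ∧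
          weightAK₁₃ θ hP K₀ g₀ os (kr F θ hP g₀ os) K t u ≤ Real.exp (sA K t u) * (mA K t u * RA K))
    (hB : letI : DecidableEq (Σ K, SiteSeqKey F (K₀ + K)) := Classical.decEq _
      ∀ (K : ℕ) (t : ℝ), |t| ≤ 1 → ∀ u ∈ classSetK₁₃ θ K₀ g₀ (kr F θ hP g₀ os) K \ badClassK₁₃ θ K₀ g₀ (kr F θ hP g₀ os) (bd F θ hP g₀ os) K t,
        Real.exp (-sB K t u) * (mB K t u * RB K) ≤ weightBK₁₃ θ hP K₀ g₀ os (kr F θ hP g₀ os) K t u ∧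
          weightBK₁₃ θ hP K₀ g₀ os (kr F θ hP g₀ os) K t u ≤ Real.exp (sB K t u) * (mB K t u * RB K))
    (hS : letI : DecidableEq (Σ K, SiteSeqKey F (K₀ + K)) := Classical.decEq _
      ∀ (K : ℕ) (t : ℝ), |t| ≤ 1 → ∀ u ∈ classSetK₁₃ θ K₀ g₀ (kr F θ hP g₀ os) K \ badClassK₁₃ θ K₀ g₀ (kr F θ hP g₀ os) (bd F θ hP g₀ os) K t,
        sA K t u ≤ SA K ∧ sB K t u ≤ SB K)
    (hmA : letI : DecidableEq (Σ K, SiteSeqKey F (K₀ + K)) := Classical.decEq _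
      ∀ (K : ℕ) (t : ℝ), |t| ≤ 1 → ∀ u ∈ classSetK₁₃ θ K₀ g₀ (kr F θ hP g₀ os) K \ badClassK₁₃ θ K₀ g₀ (kr F θ hP g₀ os) (bd F θ hP g₀ os) K t, 0 ≤ mA K t u)
    (hRA : ∀ K, 0 < RA K) (hRB : ∀ K, 0 < RB K)
    (hW : RelWeightBound 1 (classSetK₁₃ θ K₀ g₀ (kr F θ hP g₀ os)) (weightAK₁₃ θ hP K₀ g₀ os (kr F θ hP g₀ os)) (weightBK₁₃ θ hP K₀ g₀ os (kr F θ hP g₀ os))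
      (badClassK₁₃ θ K₀ g₀ (kr F θ hP g₀ os) (bd F θ hP g₀ os)) W)
    (hA0 : ∀ (K : ℕ) (t : ℝ), |t| ≤ 1 → ∀ x ∈ classSet₁₃ θ K₀ g₀ K, 0 ≤ weightA₁₃ θ hP K₀ g₀ os K t x)
    (hrad : Summable fun K => r K + (SA K + SB K) / ((F.side : ℝ) ^ 4)) :
    let cr := crOfRecord₁₃KAt K₀ kr bd (fun _ _ _ _ _ => (fun _ _ _ => 0, fun _ _ _ => 0)) F θ hP g₀ os
    RelWeightBound cr.l₀ cr.T cr.A cr.B cr.Bad cr.W ∧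
      (letI := cr.dec
       Core cr.l₀ cr.vol cr.T cr.Bad (fun K t τ => cr.A K t τ - cr.shA K t τ) (fun K t τ => cr.B K t τ - cr.shB K t τ) cr.δ) ∧ Summable cr.δ := by
  letI iS : DecidableEq (Σ K, SiteSeqKey F (K₀ + K)) := Classical.decEq _
  have hvol : (0 : ℝ) < (F.side : ℝ) ^ 4 := pow_pos F.side_pos 4
  -- the class form ⇒ `Core` for the coarse class weights
  have hcore := core_of_classFactorisation (l₀ := 1) (vol := (F.side : ℝ) ^ 4) (T := classSetK₁₃ θ K₀ g₀ (kr F θ hP g₀ os))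
    (Bad := badClassK₁₃ θ K₀ g₀ (kr F θ hP g₀ os) (bd F θ hP g₀ os)) hvol hA hB hS hmA hRA hRB hyoung
  -- zero shells: the cores are the class weights
  have hcore0 : Core 1 ((F.side : ℝ) ^ 4) (classSetK₁₃ θ K₀ g₀ (kr F θ hP g₀ os)) (badClassK₁₃ θ K₀ g₀ (kr F θ hP g₀ os) (bd F θ hP g₀ os))
      (fun K t u => weightAK₁₃ θ hP K₀ g₀ os (kr F θ hP g₀ os) K t u - (0 : ℝ)) (fun K t u => weightBK₁₃ θ hP K₀ g₀ os (kr F θ hP g₀ os) K t u - (0 : ℝ))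
      (fun K => r K + (SA K + SB K) / ((F.side : ℝ) ^ 4)) := by
    simpa only [sub_zero] using hcore
  have hP0 : ∀ (K : ℕ) (t : ℝ), |t| ≤ 1 → ∀ u ∈ classSetK₁₃ θ K₀ g₀ (kr F θ hP g₀ os) K \ badClassK₁₃ θ K₀ g₀ (kr F θ hP g₀ os) (bd F θ hP g₀ os) K t,
      0 ≤ weightAK₁₃ θ hP K₀ g₀ os (kr F θ hP g₀ os) K t u - (0 : ℝ) := fun K t ht u _ => by
    rw [sub_zero]
    exact weightAK₁₃_nonneg θ hP K₀ g₀ os (kr F θ hP g₀ os) (hA0 K t ht) u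
  exact ⟨relWeightBound_crOfRecord₁₃KAt K₀ kr bd _ θ hP g₀ os hW, core_crOfRecord₁₃KAt K₀ kr bd _ θ hP g₀ os hP0 hcore0 hrad⟩

/-! ## §2 The instance at the window dial of record [bookkeeping] -/

/-- **★ THE SAME AT THE LEVEL-WINDOW DIAL `windowKeyReading₁₃ K₀ c`** [bookkeeping] (dag-n20-d's window VALUE of the dial, floor reading `c`; ANY bad-key reading `bd` — e.g. the
first-window-level flag or a forgiving flag): the three letters at the window-keyed coarse carriers ⇒ the N20 ∧ N19′ face bodies at `crOfRecord₁₃KAt K₀ (windowKeyReading₁₃ K₀ c) bd 0`. -/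
theorem faces_windowReading_zeroShell_of_lawMergeLetters (c : FloorReading₁₃ N)
    {mA mB sA sB : ℕ → ℝ → (Σ K, SiteSeqKey F (K₀ + K)) → ℝ} {RA RB SA SB r W : ℕ → ℝ}
    (hyoung : letI : DecidableEq (Σ K, SiteSeqKey F (K₀ + K)) := Classical.decEq _
      Core 1 ((F.side : ℝ) ^ 4) (classSetK₁₃ θ K₀ g₀ (fun _ x => windowKeySigma F (c F θ hP g₀ os) x))
        (badClassK₁₃ θ K₀ g₀ (fun _ x => windowKeySigma F (c F θ hP g₀ os) x) (bd F θ hP g₀ os)) mA mB r)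
    (hA : letI : DecidableEq (Σ K, SiteSeqKey F (K₀ + K)) := Classical.decEq _
      ∀ (K : ℕ) (t : ℝ), |t| ≤ 1 → ∀ u ∈ classSetK₁₃ θ K₀ g₀ (fun _ x => windowKeySigma F (c F θ hP g₀ os) x) K \
          badClassK₁₃ θ K₀ g₀ (fun _ x => windowKeySigma F (c F θ hP g₀ os) x) (bd F θ hP g₀ os) K t,
        Real.exp (-sA K t u) * (mA K t u * RA K) ≤ weightAK₁₃ θ hP K₀ g₀ os (fun _ x => windowKeySigma F (c F θ hP g₀ os) x) K t u ∧
          weightAK₁₃ θ hP K₀ g₀ os (fun _ x => windowKeySigma F (c F θ hP g₀ os) x) K t u ≤ Real.exp (sA K t u) * (mA K t u * RA K))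
    (hB : letI : DecidableEq (Σ K, SiteSeqKey F (K₀ + K)) := Classical.decEq _
      ∀ (K : ℕ) (t : ℝ), |t| ≤ 1 → ∀ u ∈ classSetK₁₃ θ K₀ g₀ (fun _ x => windowKeySigma F (c F θ hP g₀ os) x) K \
          badClassK₁₃ θ K₀ g₀ (fun _ x => windowKeySigma F (c F θ hP g₀ os) x) (bd F θ hP g₀ os) K t,
        Real.exp (-sB K t u) * (mB K t u * RB K) ≤ weightBK₁₃ θ hP K₀ g₀ os (fun _ x => windowKeySigma F (c F θ hP g₀ os) x) K t u ∧
          weightBK₁₃ θ hP K₀ g₀ os (fun _ x => windowKeySigma F (c F θ hP g₀ os) x) K t u ≤ Real.exp (sB K t u) * (mB K t u * RB K))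
    (hS : letI : DecidableEq (Σ K, SiteSeqKey F (K₀ + K)) := Classical.decEq _
      ∀ (K : ℕ) (t : ℝ), |t| ≤ 1 → ∀ u ∈ classSetK₁₃ θ K₀ g₀ (fun _ x => windowKeySigma F (c F θ hP g₀ os) x) K \
          badClassK₁₃ θ K₀ g₀ (fun _ x => windowKeySigma F (c F θ hP g₀ os) x) (bd F θ hP g₀ os) K t, sA K t u ≤ SA K ∧ sB K t u ≤ SB K)
    (hmA : letI : DecidableEq (Σ K, SiteSeqKey F (K₀ + K)) := Classical.decEq _
      ∀ (K : ℕ) (t : ℝ), |t| ≤ 1 → ∀ u ∈ classSetK₁₃ θ K₀ g₀ (fun _ x => windowKeySigma F (c F θ hP g₀ os) x) K \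
          badClassK₁₃ θ K₀ g₀ (fun _ x => windowKeySigma F (c F θ hP g₀ os) x) (bd F θ hP g₀ os) K t, 0 ≤ mA K t u)
    (hRA : ∀ K, 0 < RA K) (hRB : ∀ K, 0 < RB K)
    (hW : RelWeightBound 1 (classSetK₁₃ θ K₀ g₀ (fun _ x => windowKeySigma F (c F θ hP g₀ os) x))
      (weightAK₁₃ θ hP K₀ g₀ os (fun _ x => windowKeySigma F (c F θ hP g₀ os) x)) (weightBK₁₃ θ hP K₀ g₀ os (fun _ x => windowKeySigma F (c F θ hP g₀ os) x))
      (badClassK₁₃ θ K₀ g₀ (fun _ x => windowKeySigma F (c F θ hP g₀ os) x) (bd F θ hP g₀ os)) W)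
    (hA0 : ∀ (K : ℕ) (t : ℝ), |t| ≤ 1 → ∀ x ∈ classSet₁₃ θ K₀ g₀ K, 0 ≤ weightA₁₃ θ hP K₀ g₀ os K t x)
    (hrad : Summable fun K => r K + (SA K + SB K) / ((F.side : ℝ) ^ 4)) :
    let cr := crOfRecord₁₃KAt K₀ (windowKeyReading₁₃ K₀ c) bd (fun _ _ _ _ _ => (fun _ _ _ => 0, fun _ _ _ => 0)) F θ hP g₀ os
    RelWeightBound cr.l₀ cr.T cr.A cr.B cr.Bad cr.W ∧
      (letI := cr.dec
       Core cr.l₀ cr.vol cr.T cr.Bad (fun K t τ => cr.A K t τ - cr.shA K t τ) (fun K t τ => cr.B K t τ - cr.shB K t τ) cr.δ) ∧ Summable cr.δ :=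
  faces_crOfRecord₁₃KAt_zeroShell_of_lawMergeLetters K₀ (windowKeyReading₁₃ K₀ c) bd θ hP g₀ os hyoung hA hB hS hmA hRA hRB hW hA0 hrad

end Summit.QuantumFields.YangMills.BalabanUVNodes.N19LawMergeSocketAtKeyReading
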